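import Literature.Topology.FourManifolds.RadialDiffeomorph
import HarnessLib

/-!
# A radial diffeomorphism of Euclidean space onto a ball, the identity on the unit ball

We construct a `C^∞` diffeomorphism `Literature.stretch : E → B(0, 3)` of a real inner product space
onto its open ball of radius `3` which is the identity on the closed unit ball (indeed on
`‖z‖ ≤ 1`), packaged as the open partial homeomorphism `Literature.Topology.FourManifolds.stretchPartialHomeomorph` (source
`univ`, target `ball 0 3`, `C^∞` with `C^∞` inverse). It is the radial map `t • u ↦ λ t • u` with
the *stretch profile* `λ t = t + χ (t - 1) (3 - 1/t - t)`, `χ = Real.smoothTransition`: `λ t = t`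
for `t ≤ 1`, `λ t = 3 - 1/t` for `t ≥ 2`, `λ' > 0`. Such maps are used to turn a smooth
embedding of a neighbourhood of the closed unit ball into one of the whole space without changing
it on the unit ball (here: for the straddling disc of `Literature.Topology.FourManifolds.exists_seamAdaptedWitnesses`).

## References

* M. W. Hirsch, *Differential Topology*, GTM 33, Springer (1976), Ch. 8 (isotopy and disc
  arguments of this kind are standard; the profile is ad hoc).
-/

open scoped ContDiff Topology
open Set Function Metric Real

noncomputable section

namespace Literature.Topology.FourManifolds

/-! ### §1 The stretch profile -/

section Profile

/-- The **stretch profile** `λ t = t + χ (t - 1) (3 - t⁻¹ - t)`, `χ = smoothTransition`: equal to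
`t` for `t ≤ 1`, to `3 - t⁻¹` for `t ≥ 2`, strictly increasing with positive derivative, with
values in `(-∞, 3)`. [folklore] -/
def stretchProfile (t : ℝ) : ℝ := t + smoothTransition (t - 1) * (3 - t⁻¹ - t)

/-- `λ t = t` for `t ≤ 1`. [folklore] -/
theorem stretchProfile_of_le_one {t : ℝ} (h : t ≤ 1) : stretchProfile t = t := by
  rw [stretchProfile, smoothTransition.zero_of_nonpos (by linarith), zero_mul, add_zero]

/-- `λ t = 3 - t⁻¹` for `t ≥ 2`. [folklore] -/
theorem stretchProfile_of_two_le {t : ℝ} (h : 2 ≤ t) : stretchProfile t = 3 - t⁻¹ := by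
  rw [stretchProfile, smoothTransition.one_of_one_le (by linarith), one_mul]; ring

/-- `λ 0 = 0`. [folklore] -/
@[simp] theorem stretchProfile_zero : stretchProfile 0 = 0 := stretchProfile_of_le_one zero_le_one

/-- `λ` as a convex combination: `λ t = (1 - χ) t + χ (3 - t⁻¹)`. [folklore] -/
theorem stretchProfile_eq_convex (t : ℝ) :
    stretchProfile t = (1 - smoothTransition (t - 1)) * t + smoothTransition (t - 1) * (3 - t⁻¹) := by
  rw [stretchProfile]; ring

/-- `λ t < 3` for all `t`. [folklore] -/
theorem stretchProfile_lt_three (t : ℝ) : stretchProfile t < 3 := by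
  rcases le_or_gt t 1 with h1 | h1
  · rw [stretchProfile_of_le_one h1]; linarith
  · have hχ0 := smoothTransition.nonneg (t - 1)
    have hχ1 := smoothTransition.le_one (t - 1)
    have hinv : 0 < t⁻¹ := inv_pos.2 (by linarith)
    have hχpos : 0 < smoothTransition (t - 1) := smoothTransition.pos_of_pos (by linarith)
    rw [stretchProfile_eq_convex]
    rcases le_or_gt t 3 with h3 | h3
    · nlinarith [mul_nonneg (sub_nonneg.2 hχ1) (sub_nonneg.2 h3), mul_pos hχpos hinv]
    · -- `t > 3`: then `χ = 1`
      rw [smoothTransition.one_of_one_le (by linarith)]; nlinarith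

/-- `0 < λ t` for `t > 0`. [folklore] -/
theorem stretchProfile_pos {t : ℝ} (ht : 0 < t) : 0 < stretchProfile t := by
  rcases le_or_gt t 1 with h1 | h1
  · rw [stretchProfile_of_le_one h1]; exact ht
  · have hχ0 := smoothTransition.nonneg (t - 1)
    have hχ1 := smoothTransition.le_one (t - 1)
    have hinv : t⁻¹ < 1 := inv_lt_one_of_one_lt₀ h1
    rw [stretchProfile_eq_convex]
    nlinarith

/-- `0 ≤ λ t` for `t ≥ 0`. [folklore] -/
theorem stretchProfile_nonneg {t : ℝ} (ht : 0 ≤ t) : 0 ≤ stretchProfile t := by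
  rcases ht.eq_or_lt with h | h
  · rw [← h, stretchProfile_zero]
  · exact (stretchProfile_pos h).le

/-- `λ` is smooth at every `t ≠ 0` (a formula in `t⁻¹`). [folklore] -/
theorem contDiffAt_stretchProfile_of_ne {t : ℝ} (ht : t ≠ 0) : ContDiffAt ℝ ∞ stretchProfile t := by
  have h1 : ContDiffAt ℝ ∞ (fun t : ℝ => smoothTransition (t - 1)) t :=
    smoothTransition.contDiff.contDiffAt.comp t (contDiffAt_id.sub contDiffAt_const)
  have h2 : ContDiffAt ℝ ∞ (fun t : ℝ => 3 - t⁻¹ - t) t :=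
    (contDiffAt_const.sub (contDiffAt_inv ℝ ht)).sub contDiffAt_id
  exact contDiffAt_id.add (h1.mul h2)

/-- `λ` is smooth (near `t ≤ 1/2` it is the identity). [folklore] -/
theorem contDiff_stretchProfile : ContDiff ℝ ∞ stretchProfile := by
  rw [contDiff_iff_contDiffAt]
  intro t
  rcases eq_or_ne t 0 with rfl | ht
  · have hev : stretchProfile =ᶠ[𝓝 (0 : ℝ)] id :=
      Filter.eventuallyEq_of_mem (Iio_mem_nhds (by norm_num : (0 : ℝ) < 1))
        fun s hs => stretchProfile_of_le_one (le_of_lt hs)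
    exact contDiffAt_id.congr_of_eventuallyEq hev
  · exact contDiffAt_stretchProfile_of_ne ht

/-- `λ` is differentiable. [folklore] -/
theorem differentiable_stretchProfile : Differentiable ℝ stretchProfile :=
  contDiff_stretchProfile.differentiable (by simp)

/-- The cut-off factor `t ↦ χ (t - 1)` is differentiable with nonnegative derivative. [folklore] -/
theorem hasDerivAt_smoothTransition_sub_one (t : ℝ) :
    HasDerivAt (fun t : ℝ => smoothTransition (t - 1)) (deriv smoothTransition (t - 1)) t := by
  have hd : Differentiable ℝ smoothTransition :=
    (smoothTransition.contDiff (n := 1)).differentiable one_ne_zero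
  have h := (hd (t - 1)).hasDerivAt.comp t ((hasDerivAt_id t).sub_const 1)
  rw [mul_one] at h
  exact h

/-- `χ' ≥ 0`. [folklore] -/
theorem deriv_smoothTransition_nonneg (s : ℝ) : 0 ≤ deriv smoothTransition s :=
  (((smoothTransition.contDiff (n := 1)).differentiable one_ne_zero) s).hasDerivAt.nonneg_of_monotone
    smoothTransition.monotone

/-- `χ' s = 0` for `s < 0`. [folklore] -/
theorem deriv_smoothTransition_of_neg {s : ℝ} (h : s < 0) : deriv smoothTransition s = 0 := by
  have : smoothTransition =ᶠ[𝓝 s] fun _ => 0 :=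
    Filter.eventuallyEq_of_mem (Iio_mem_nhds h) fun x hx => smoothTransition.zero_of_nonpos (le_of_lt hx)
  rw [this.deriv_eq, deriv_const]

/-- `χ' s = 0` for `s > 1`. [folklore] -/
theorem deriv_smoothTransition_of_one_lt {s : ℝ} (h : 1 < s) : deriv smoothTransition s = 0 := by
  have : smoothTransition =ᶠ[𝓝 s] fun _ => 1 :=
    Filter.eventuallyEq_of_mem (Ioi_mem_nhds h) fun x hx => smoothTransition.one_of_one_le (le_of_lt hx)
  rw [this.deriv_eq, deriv_const]

/-- **The derivative of `λ`** at `t ≠ 0`: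
`λ' t = 1 + χ'(t - 1) (3 - t⁻¹ - t) + χ (t - 1) (t⁻² - 1)`. [folklore] -/
theorem hasDerivAt_stretchProfile {t : ℝ} (ht : t ≠ 0) :
    HasDerivAt stretchProfile (1 + (deriv smoothTransition (t - 1) * (3 - t⁻¹ - t) +
      smoothTransition (t - 1) * ((t ^ 2)⁻¹ - 1))) t := by
  have h1 := hasDerivAt_smoothTransition_sub_one t
  have h2 : HasDerivAt (fun t : ℝ => 3 - t⁻¹ - t) ((t ^ 2)⁻¹ - 1) t := by
    have := ((hasDerivAt_const t (3 : ℝ)).fun_sub (hasDerivAt_inv ht)).fun_sub (hasDerivAt_id t)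
    simpa using this
  have h := (hasDerivAt_id' t).fun_add (h1.fun_mul h2)
  exact h

/-- **`λ' > 0`.** For `t ≤ 1` the profile is the identity near `t`; for `t ≥ 1` the derivative is
`(1 - χ) + χ t⁻² + χ' (3 - t⁻¹ - t)` with `χ' ≥ 0` and `3 - t⁻¹ - t ≥ 0` as long as `χ' ≠ 0`
(i.e. `t ≤ 2`). [folklore] -/
theorem deriv_stretchProfile_pos (t : ℝ) : 0 < deriv stretchProfile t := by
  rcases lt_or_ge t 1 with h1 | h1
  · -- identity near `t`
    have hev : stretchProfile =ᶠ[𝓝 t] id :=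
      Filter.eventuallyEq_of_mem (Iio_mem_nhds h1) fun s hs => stretchProfile_of_le_one (le_of_lt hs)
    rw [hev.deriv_eq, deriv_id]
    try norm_num
  · have ht : t ≠ 0 := by rintro rfl; linarith
    rw [(hasDerivAt_stretchProfile ht).deriv]
    have hχ0 := smoothTransition.nonneg (t - 1)
    have hχ1 := smoothTransition.le_one (t - 1)
    have hd := deriv_smoothTransition_nonneg (t - 1)
    have ht2 : 0 < (t ^ 2)⁻¹ := by positivity
    -- the cut-off term is nonnegative
    have hcut : 0 ≤ deriv smoothTransition (t - 1) * (3 - t⁻¹ - t) := by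
      rcases le_or_gt t (5 / 2) with h52 | h52
      · refine mul_nonneg hd ?_
        have htpos : 0 < t := by linarith
        have hkey : 0 ≤ 3 * t - 1 - t ^ 2 := by nlinarith
        have : 3 - t⁻¹ - t = (3 * t - 1 - t ^ 2) / t := by field_simp
        rw [this]; exact div_nonneg hkey htpos.le
      · rw [deriv_smoothTransition_of_one_lt (by linarith), zero_mul]
    -- the blend term is positive
    have hblend : 0 < 1 + smoothTransition (t - 1) * ((t ^ 2)⁻¹ - 1) := by
      have : 1 + smoothTransition (t - 1) * ((t ^ 2)⁻¹ - 1) =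
          (1 - smoothTransition (t - 1)) + smoothTransition (t - 1) * (t ^ 2)⁻¹ := by ring
      rw [this]
      rcases hχ1.lt_or_eq with hlt | heq
      · exact add_pos_of_pos_of_nonneg (by linarith) (mul_nonneg hχ0 ht2.le)
      · rw [heq]; linarith
    linarith

/-- `λ` is strictly increasing. [folklore] -/
theorem strictMono_stretchProfile : StrictMono stretchProfile :=
  strictMono_of_deriv_pos deriv_stretchProfile_pos

/-- `λ` is injective. [folklore] -/
theorem injective_stretchProfile : Injective stretchProfile := strictMono_stretchProfile.injective

/-- `λ` maps `[0, ∞)` onto `[0, 3)`. [folklore] -/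
theorem exists_stretchProfile_eq {s : ℝ} (hs0 : 0 ≤ s) (hs3 : s < 3) : ∃ t, 0 ≤ t ∧ stretchProfile t = s := by
  -- at `T = max 2 (1 / (3 - s)) + 1` the profile exceeds `s`
  set T : ℝ := max 2 (1 / (3 - s)) + 1 with hT
  have hT2 : 2 ≤ T := by rw [hT]; linarith [le_max_left 2 (1 / (3 - s))]
  have h3s : 0 < 3 - s := by linarith
  have hTs : s ≤ stretchProfile T := by
    rw [stretchProfile_of_two_le hT2]
    have h1 : 1 / (3 - s) < T := by rw [hT]; linarith [le_max_right 2 (1 / (3 - s))]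
    have hTpos : 0 < T := by linarith
    have : T⁻¹ < 3 - s := by
      rw [inv_lt_comm₀ hTpos h3s, ← one_div]; exact h1
    linarith
  have hc : ContinuousOn stretchProfile (Icc 0 T) := contDiff_stretchProfile.continuous.continuousOn
  obtain ⟨t, ht, hts⟩ := intermediate_value_Icc (by linarith : (0 : ℝ) ≤ T) hc
    ⟨by rw [stretchProfile_zero]; exact hs0, hTs⟩
  exact ⟨t, ht.1, hts⟩

/-- The inverse profile `λ⁻¹` (a global left inverse of the injective `λ`). [folklore] -/
def stretchProfileInv : ℝ → ℝ := invFun stretchProfile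

/-- `λ⁻¹ (λ t) = t`. [folklore] -/
theorem stretchProfileInv_stretchProfile (t : ℝ) : stretchProfileInv (stretchProfile t) = t :=
  leftInverse_invFun injective_stretchProfile t

/-- `λ⁻¹ s = s` for `s ≤ 1`. [folklore] -/
theorem stretchProfileInv_of_le_one {s : ℝ} (h : s ≤ 1) : stretchProfileInv s = s := by
  conv_lhs => rw [← stretchProfile_of_le_one h]
  exact stretchProfileInv_stretchProfile s

/-- `λ⁻¹` is smooth at `λ t` (inverse function theorem, `λ' t > 0`). [folklore] -/
theorem contDiffAt_stretchProfileInv (t : ℝ) : ContDiffAt ℝ ∞ stretchProfileInv (stretchProfile t) :=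
  contDiffAt_leftInverse_of_hasDerivAt contDiff_stretchProfile.contDiffAt
    (differentiable_stretchProfile t).hasDerivAt (deriv_stretchProfile_pos t).ne' (by simp)
    (leftInverse_invFun injective_stretchProfile)

end Profile

/-! ### §2 The stretch diffeomorphism `E ≅ B(0, 3)` -/

section Stretch

variable {E : Type*} [NormedAddCommGroup E] [InnerProductSpace ℝ E]

/-- The **stretch** `t • u ↦ λ t • u`: a diffeomorphism of `E` onto `B(0, 3)`, the identity on the
closed unit ball. [folklore] -/
def stretch : E → E := radialMap stretchProfile

/-- The inverse of the stretch (on `B(0, 3)`). [folklore] -/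
def stretchInv : E → E := radialMap stretchProfileInv

/-- `stretch 0 = 0`. [folklore] -/
theorem stretch_zero : stretch (0 : E) = 0 := radialMap_zero _

/-- `‖stretch z‖ = λ ‖z‖`. [folklore] -/
theorem norm_stretch (z : E) : ‖stretch z‖ = stretchProfile ‖z‖ := by
  rcases eq_or_ne z 0 with rfl | hz
  · rw [stretch_zero, norm_zero, stretchProfile_zero]
  · rw [stretch, norm_radialMap _ hz, abs_of_pos (stretchProfile_pos (norm_pos_iff.2 hz))]

/-- The stretch maps into `B(0, 3)`. [folklore] -/
theorem norm_stretch_lt (z : E) : ‖stretch z‖ < 3 := by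
  rw [norm_stretch]; exact stretchProfile_lt_three _

/-- **The stretch is the identity on the closed unit ball.** [folklore] -/
theorem stretch_eq_self {z : E} (hz : ‖z‖ ≤ 1) : stretch z = z :=
  radialMap_eq_self _ (stretchProfile_of_le_one hz)

/-- The stretch is smooth (the identity near the origin, radial with smooth profile elsewhere).
[folklore] -/
theorem contDiff_stretch : ContDiff ℝ ∞ (stretch : E → E) := by
  rw [contDiff_iff_contDiffAt]
  intro z
  rcases eq_or_ne z 0 with rfl | hz
  · have hev : (stretch : E → E) =ᶠ[𝓝 0] id :=
      Filter.eventuallyEq_of_mem (ball_mem_nhds (0 : E) one_pos)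
        fun w hw => stretch_eq_self (le_of_lt (by simpa using hw))
    exact contDiffAt_id.congr_of_eventuallyEq hev
  · exact contDiffAt_radialMap hz contDiff_stretchProfile.contDiffAt

/-- The stretch is continuous. [folklore] -/
theorem continuous_stretch : Continuous (stretch : E → E) := contDiff_stretch.continuous

/-- `stretch⁻¹ (stretch z) = z`. [folklore] -/
theorem stretchInv_stretch (z : E) : stretchInv (stretch z) = z := by
  rcases eq_or_ne z 0 with rfl | hz
  · rw [stretch_zero, stretchInv, radialMap_zero]
  · rw [stretchInv, stretch, radialMap_radialMap _ _ hz (stretchProfile_pos (norm_pos_iff.2 hz)),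
      stretchProfileInv_stretchProfile, mul_inv_cancel₀ (norm_ne_zero_iff.2 hz), one_smul]

/-- The stretch is injective. [folklore] -/
theorem injective_stretch : Injective (stretch : E → E) :=
  LeftInverse.injective stretchInv_stretch

/-- `stretch (stretch⁻¹ y) = y` for `‖y‖ < 3`. [folklore] -/
theorem stretch_stretchInv {y : E} (hy : ‖y‖ < 3) : stretch (stretchInv y) = y := by
  rcases eq_or_ne y 0 with rfl | hy0
  · rw [stretchInv, radialMap_zero, stretch_zero]
  · obtain ⟨t, ht0, hty⟩ := exists_stretchProfile_eq (norm_nonneg y) hy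
    have htpos : 0 < t := by
      rcases ht0.eq_or_lt with h | h
      · exfalso; rw [← h, stretchProfile_zero] at hty
        exact hy0 (norm_eq_zero.1 hty.symm)
      · exact h
    have hinv : stretchProfileInv ‖y‖ = t := by rw [← hty, stretchProfileInv_stretchProfile]
    rw [stretch, stretchInv, radialMap_radialMap _ _ hy0 (by rw [hinv]; exact htpos), hinv, hty,
      mul_inv_cancel₀ (norm_ne_zero_iff.2 hy0), one_smul]

/-- **The inverse stretch is the identity on the closed unit ball.** [folklore] -/
theorem stretchInv_eq_self {y : E} (hy : ‖y‖ ≤ 1) : stretchInv y = y :=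
  radialMap_eq_self _ (stretchProfileInv_of_le_one hy)

/-- The inverse stretch is smooth at the points of `B(0, 3)`. [folklore] -/
theorem contDiffAt_stretchInv {y : E} (hy : ‖y‖ < 3) : ContDiffAt ℝ ∞ (stretchInv : E → E) y := by
  rcases eq_or_ne y 0 with rfl | hy0
  · have hev : (stretchInv : E → E) =ᶠ[𝓝 0] id :=
      Filter.eventuallyEq_of_mem (ball_mem_nhds (0 : E) one_pos)
        fun w hw => stretchInv_eq_self (le_of_lt (by simpa using hw))
    exact contDiffAt_id.congr_of_eventuallyEq hev
  · obtain ⟨t, -, hty⟩ := exists_stretchProfile_eq (norm_nonneg y) hy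
    refine contDiffAt_radialMap hy0 ?_
    rw [← hty]
    exact contDiffAt_stretchProfileInv t

/-- The inverse stretch is smooth on `B(0, 3)`. [folklore] -/
theorem contDiffOn_stretchInv : ContDiffOn ℝ ∞ (stretchInv : E → E) (ball 0 3) :=
  fun _ hy => (contDiffAt_stretchInv (by simpa using hy)).contDiffWithinAt

/-- **The stretch as a partial homeomorphism `E ≃ B(0, 3)`** with source `univ`, smooth with smooth
inverse (`contDiff_stretch`, `contDiffOn_stretchInv`), the identity on the closed unit ball
(`stretch_eq_self`). [folklore] -/
def stretchPartialHomeomorph : OpenPartialHomeomorph E E where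
  toFun := stretch
  invFun := stretchInv
  source := univ
  target := ball 0 3
  map_source' z _ := by simpa using norm_stretch_lt z
  map_target' _ _ := mem_univ _
  left_inv' z _ := stretchInv_stretch z
  right_inv' _ hy := stretch_stretchInv (by simpa using hy)
  open_source := isOpen_univ
  open_target := isOpen_ball
  continuousOn_toFun := continuous_stretch.continuousOn
  continuousOn_invFun := contDiffOn_stretchInv.continuousOn

/-- `stretchPartialHomeomorph` acts as the stretch. [folklore] -/
@[simp] theorem stretchPartialHomeomorph_coe :
    ⇑(stretchPartialHomeomorph : OpenPartialHomeomorph E E) = stretch := rfl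

/-- Its inverse acts as the inverse stretch. [folklore] -/
@[simp] theorem stretchPartialHomeomorph_symm_coe :
    ⇑(stretchPartialHomeomorph : OpenPartialHomeomorph E E).symm = stretchInv := rfl

/-- Its source is everything. [folklore] -/
@[simp] theorem stretchPartialHomeomorph_source :
    (stretchPartialHomeomorph : OpenPartialHomeomorph E E).source = univ := rfl

/-- Its target is `B(0, 3)`. [folklore] -/
@[simp] theorem stretchPartialHomeomorph_target :
    (stretchPartialHomeomorph : OpenPartialHomeomorph E E).target = ball 0 3 := rfl

/-- The stretch is `C^∞` on its source and its inverse on its target (the form consumed by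
`Literature.Topology.FourManifolds.isImmersionAtOfComplement_of_eventuallyEq_openPartialHomeomorph`). [folklore] -/
theorem contDiffOn_stretchPartialHomeomorph :
    ContDiffOn ℝ ∞ (stretchPartialHomeomorph : OpenPartialHomeomorph E E)
      (stretchPartialHomeomorph : OpenPartialHomeomorph E E).source ∧
    ContDiffOn ℝ ∞ (stretchPartialHomeomorph : OpenPartialHomeomorph E E).symm
      (stretchPartialHomeomorph : OpenPartialHomeomorph E E).target :=
  ⟨contDiff_stretch.contDiffOn, contDiffOn_stretchInv⟩

end Stretch

end Literature.Topology.FourManifolds
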